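import Mathlib
import HarnessLib
import Literature.Analysis.FluidPDE.TypeIAncientMild
import Summits.NavierStokesRegularity.NavierStokesRegularity.Theorems.PoloidalWindowDoorPoloidalWindowRigidityWindow
import Summits.NavierStokesRegularity.NavierStokesRegularity.Theorems.PoloidalWindowDoorPoloidalWindowRigidityHotLoopsReduction

/-!
# Route `PoloidalWindowDoor`, crux `PoloidalWindowRigidity` (K2, stmt-NavierStokesRegularity-19708) — line `hot_loops` v4.1 (ns-idea-8 g6):
# TYPED HANDLES ON THE PEAKLESS RESIDUE HL3′, modulo the wall

Cell ns-regularity-ideate, seat ns-poloidal-K2-p2 g11 (stub-worker on K2; `--supports` the crux item; closes NO item).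

For the PINNED class profile of S3 (`N := v₂(−1,0) ≠ 0`, `√(−t)|v₂(t,x)| ≤ |N|` everywhere) write `Hot := {y : y₂ = 0, v₂(−1,y) = N}` for the hot set
of the plane `P_0` (`∋ 0`).  From `…HotLoopsReduction.zero_of_island`, CONDITIONAL on the wall `hG : LoopPeriodRatchet.FrequencyGrowthExponent` (item
stmt-NavierStokesRegularity-27893, OPEN):

* `zero_of_strictPlanarExtremum` — PIN-FREE: a strict local planar maximum of `σ·v₂(s,·)|_{P_{y₂}}` (`σ = ±1`) at any point, any time, forces
  `v ≡ 0` (the `v₂`-analogue of the PROVED `LoopPeriodRatchet.NoPlanarExtremum` for `ψ`);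
* `hot_noCompactPiece_of_growth` — `Hot` has NO non-empty compact piece `K = Hot ∩ O` cut out by an open `O` (such a piece is an island bracket with
  `σ = sign N`, `M = |N|`, the guard inequality being the pin `|v₂(−1,·)| ≤ |N|`; `zero_of_island` gives `v ≡ 0`, contradicting `N ≠ 0`);
* `hot_not_bounded_of_growth` — hence `Hot` is UNBOUNDED (it is closed, and `0 ∈ Hot`);
* `hot_not_isolated_of_growth` — and PERFECT: every hot point is a limit of other hot points (no strict planar hot spot anywhere on `P_0`).

These are the typed content of HL3′ `stub_peaklessEmpty` at `(−1, P_0)` that is available without the structure theory of planar analytic sets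
(whose «every component of `Hot` is unbounded, or `Hot = P_0`» is NOT claimed here).

WHAT THIS IS NOT: not a claim about Navier–Stokes regularity, K2, S3 or HL3′ — CONDITIONAL corollaries (hypothesis `hG`) for HYPOTHETICAL profiles
(bears_on LADDER-NS N0, rung N0-LocalTubeDoorPoloidal).
-/

noncomputable section

-- the summit and its single sub-problem share the name (CONVENTIONS §1), as in every Theorems file
set_option linter.dupNamespace false

namespace Summit.NavierStokesRegularity.NavierStokesRegularity.Theorems.PoloidalWindowDoorPoloidalWindowRigidityHotLoopsPeakless

open MeasureTheory Set Function Filter Topology Metric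
open scoped RealInnerProductSpace InnerProductSpace
open Literature.Analysis Literature.Analysis.FluidPDE
open Summit.NavierStokesRegularity.NavierStokesRegularity.Theorems.PoloidalWindowDoorPoloidalWindowRigidityWindow
open Summit.NavierStokesRegularity.NavierStokesRegularity.Theorems.PoloidalWindowDoorPoloidalWindowRigidityHotLoopsReduction

/-- **Modulo the wall, `v₂` has NO STRICT LOCAL PLANAR EXTREMUM anywhere, ever, unless `v ≡ 0`** (pin-free): if for some time `s < 0`, point `y`
and sign `σ = ±1` the planar function `σ·v₂(s,·)|_{P_{y₂}}` has a strict local maximum at `y` (stated with the punctured planar neighbourhood filter, as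
in `LoopPeriodRatchet.PlanarExtremumLiouville`), then `{y}` with a small ball is an island bracket and `zero_of_island` gives `v ≡ 0` on `(−∞,0) × ℝ³`.
CONDITIONAL on `hG : LoopPeriodRatchet.FrequencyGrowthExponent` (item 27893).  The `v₂`-analogue of the PROVED `LoopPeriodRatchet.NoPlanarExtremum` (for `ψ`). -/
theorem zero_of_strictPlanarExtremum
    (hG : Summit.NavierStokesRegularity.NavierStokesRegularity.Theses.LoopPeriodRatchet.FrequencyGrowthExponent) :
    ∀ (C : ℝ) (v : ℝ → EuclideanSpace ℝ (Fin 3) → EuclideanSpace ℝ (Fin 3)),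
      Literature.Analysis.FluidPDE.HasTypeITimeDecay C v →
      ContinuousOn (Function.uncurry v) (Set.Iio (0 : ℝ) ×ˢ Set.univ) →
      (∀ s t : ℝ, s < t → t < 0 → ∀ x, v t x =
        Literature.Analysis.UnboundedOperators.heatExtension (v s) (t - s) x -
          Literature.Analysis.FluidPDE.oseenDuhamel 1 s v v t x) →
      (∀ t < 0, Literature.Analysis.FluidPDE.VectorCalculus.IsDivFree (v t)) →
      (∀ s < 0, ∀ y, ⟪Literature.Analysis.FluidPDE.curl (v s) y, EuclideanSpace.single 2 1⟫_ℝ = 0) →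
      ∀ (s σ : ℝ) (y : EuclideanSpace ℝ (Fin 3)), s < 0 → (σ = 1 ∨ σ = -1) →
        (∀ᶠ y' in nhdsWithin y {y' | y' 2 = y 2 ∧ y' ≠ y}, σ * v s y' 2 < σ * v s y 2) →
        ∀ t < 0, ∀ x, v t x = 0 := by
  intro C v hrate hcont hmild hdiv hpol s σ y hs hσ hstrict
  obtain ⟨r, hr, hball⟩ : ∃ r : ℝ, 0 < r ∧ ∀ y' : EuclideanSpace ℝ (Fin 3), dist y' y < r → y' 2 = y 2 → y' ≠ y →
      σ * v s y' 2 < σ * v s y 2 := by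
    obtain ⟨U, hUo, hyU, hUsub⟩ := mem_nhdsWithin.1 hstrict
    obtain ⟨r, hr, hrU⟩ := Metric.isOpen_iff.1 hUo y hyU
    exact ⟨r, hr, fun y' hy' h2 hne => hUsub ⟨hrU (mem_ball.2 hy'), h2, hne⟩⟩
  refine zero_of_island hG C v hrate hcont hmild hdiv hpol s (y 2) σ (σ * v s y 2) {y} (ball y r) hs
    ⟨hσ, isCompact_singleton, singleton_nonempty y, fun y' hy' => ?_, isOpen_ball,
      singleton_subset_iff.2 (mem_ball_self hr), fun y' hy' h2 => ?_, fun y' hy' h2 hM => ?_⟩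
  · rw [mem_singleton_iff.1 hy']; exact ⟨rfl, rfl⟩
  · by_cases hne : y' = y
    · rw [hne]
    · exact (hball y' (mem_ball.1 hy') h2 hne).le
  · by_contra hne
    exact (hball y' (mem_ball.1 hy') h2 hne).ne hM

/-- **Modulo the wall, the planar hot set of a pinned class poloidal profile has no non-empty compact piece cut out by an open set.**
CONDITIONAL on `hG : LoopPeriodRatchet.FrequencyGrowthExponent` (item 27893). -/
theorem hot_noCompactPiece_of_growth
    (hG : Summit.NavierStokesRegularity.NavierStokesRegularity.Theses.LoopPeriodRatchet.FrequencyGrowthExponent) :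
    ∀ (C : ℝ) (v : ℝ → EuclideanSpace ℝ (Fin 3) → EuclideanSpace ℝ (Fin 3)),
      Literature.Analysis.FluidPDE.HasTypeITimeDecay C v →
      ContinuousOn (Function.uncurry v) (Set.Iio (0 : ℝ) ×ˢ Set.univ) →
      (∀ s t : ℝ, s < t → t < 0 → ∀ x, v t x =
        Literature.Analysis.UnboundedOperators.heatExtension (v s) (t - s) x -
          Literature.Analysis.FluidPDE.oseenDuhamel 1 s v v t x) →
      (∀ t < 0, Literature.Analysis.FluidPDE.VectorCalculus.IsDivFree (v t)) →
      (∀ s < 0, ∀ y, ⟪Literature.Analysis.FluidPDE.curl (v s) y, EuclideanSpace.single 2 1⟫_ℝ = 0) →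
      v (-1) 0 2 ≠ 0 → (∀ t < 0, ∀ x, Real.sqrt (-t) * |v t x 2| ≤ |v (-1) 0 2|) →
      ∀ K O : Set (EuclideanSpace ℝ (Fin 3)), IsCompact K → K.Nonempty → IsOpen O → K ⊆ O →
        (∀ y ∈ K, y 2 = 0 ∧ v (-1) y 2 = v (-1) 0 2) →
        (∀ y ∈ O, y 2 = 0 → v (-1) y 2 = v (-1) 0 2 → y ∈ K) → False := by
  intro C v hrate hcont hmild hdiv hpol hN hsup K O hK hKne hO hKO hKhot hOK
  -- the sign `σ = sign N` and the level `M = |N|`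
  obtain ⟨σ, hσ, hσN⟩ : ∃ σ : ℝ, (σ = 1 ∨ σ = -1) ∧ σ * v (-1) 0 2 = |v (-1) 0 2| := by
    rcases le_or_gt 0 (v (-1) 0 2) with h | h
    · exact ⟨1, Or.inl rfl, by rw [one_mul, abs_of_nonneg h]⟩
    · exact ⟨-1, Or.inr rfl, by rw [abs_of_neg h]; ring⟩
  have hle : ∀ y : EuclideanSpace ℝ (Fin 3), σ * v (-1) y 2 ≤ |v (-1) 0 2| := by
    intro y
    have h1 := hsup (-1) (by norm_num) y
    rw [neg_neg, Real.sqrt_one, one_mul] at h1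
    have h2 : σ * v (-1) y 2 ≤ |v (-1) y 2| := by
      rcases hσ with rfl | rfl
      · rw [one_mul]; exact le_abs_self _
      · rw [neg_one_mul]; exact neg_le_abs _
    exact h2.trans h1
  have hz := zero_of_island hG C v hrate hcont hmild hdiv hpol (-1) 0 σ (|v (-1) 0 2|) K O (by norm_num)
    ⟨hσ, hK, hKne, fun y hy => ⟨(hKhot y hy).1, by rw [(hKhot y hy).2, hσN]⟩, hO, hKO,
      fun y _ _ => hle y, fun y hy hy0 hyM => hOK y hy hy0 ?_⟩ (-1) (by norm_num) 0
  · exact hN (by rw [hz]; rfl)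
  · -- `σ * v₂(y) = |N| = σ * N` with `σ = ±1`
    rcases hσ with rfl | rfl
    · linarith
    · linarith

/-- **Modulo the wall, the planar hot set `{y₂ = 0, v₂(−1,y) = v₂(−1,0)}` of a pinned class poloidal profile is UNBOUNDED.**  CONDITIONAL on `hG`. -/
theorem hot_not_bounded_of_growth
    (hG : Summit.NavierStokesRegularity.NavierStokesRegularity.Theses.LoopPeriodRatchet.FrequencyGrowthExponent) :
    ∀ (C : ℝ) (v : ℝ → EuclideanSpace ℝ (Fin 3) → EuclideanSpace ℝ (Fin 3)),
      Literature.Analysis.FluidPDE.HasTypeITimeDecay C v →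
      ContinuousOn (Function.uncurry v) (Set.Iio (0 : ℝ) ×ˢ Set.univ) →
      (∀ s t : ℝ, s < t → t < 0 → ∀ x, v t x =
        Literature.Analysis.UnboundedOperators.heatExtension (v s) (t - s) x -
          Literature.Analysis.FluidPDE.oseenDuhamel 1 s v v t x) →
      (∀ t < 0, Literature.Analysis.FluidPDE.VectorCalculus.IsDivFree (v t)) →
      (∀ s < 0, ∀ y, ⟪Literature.Analysis.FluidPDE.curl (v s) y, EuclideanSpace.single 2 1⟫_ℝ = 0) →
      v (-1) 0 2 ≠ 0 → (∀ t < 0, ∀ x, Real.sqrt (-t) * |v t x 2| ≤ |v (-1) 0 2|) →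
      ¬ Bornology.IsBounded {y : EuclideanSpace ℝ (Fin 3) | y 2 = 0 ∧ v (-1) y 2 = v (-1) 0 2} := by
  intro C v hrate hcont hmild hdiv hpol hN hsup hbdd
  have hA : IsTypeIAncientMild C v := isTypeIAncientMild_of_class hrate hcont hmild hdiv
  have hc2 : Continuous fun y : EuclideanSpace ℝ (Fin 3) => v (-1) y 2 :=
    (EuclideanSpace.proj (2 : Fin 3)).continuous.comp (hA.continuous_slice (by norm_num))
  have hclosed : IsClosed {y : EuclideanSpace ℝ (Fin 3) | y 2 = 0 ∧ v (-1) y 2 = v (-1) 0 2} :=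
    (isClosed_eq (EuclideanSpace.proj (2 : Fin 3)).continuous continuous_const).inter (isClosed_eq hc2 continuous_const)
  have hK : IsCompact {y : EuclideanSpace ℝ (Fin 3) | y 2 = 0 ∧ v (-1) y 2 = v (-1) 0 2} :=
    Metric.isCompact_of_isClosed_isBounded hclosed hbdd
  exact hot_noCompactPiece_of_growth hG C v hrate hcont hmild hdiv hpol hN hsup _ univ hK ⟨0, rfl, rfl⟩ isOpen_univ
    (subset_univ _) (fun y hy => hy) (fun y _ hy0 hyN => ⟨hy0, hyN⟩)

/-- **Modulo the wall, the planar hot set of a pinned class poloidal profile is PERFECT: no hot point is isolated among hot points** (in particular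
`v₂(−1,·)|_{P_0}` has no strict local maximum point anywhere).  CONDITIONAL on `hG`. -/
theorem hot_not_isolated_of_growth
    (hG : Summit.NavierStokesRegularity.NavierStokesRegularity.Theses.LoopPeriodRatchet.FrequencyGrowthExponent) :
    ∀ (C : ℝ) (v : ℝ → EuclideanSpace ℝ (Fin 3) → EuclideanSpace ℝ (Fin 3)),
      Literature.Analysis.FluidPDE.HasTypeITimeDecay C v →
      ContinuousOn (Function.uncurry v) (Set.Iio (0 : ℝ) ×ˢ Set.univ) →
      (∀ s t : ℝ, s < t → t < 0 → ∀ x, v t x =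
        Literature.Analysis.UnboundedOperators.heatExtension (v s) (t - s) x -
          Literature.Analysis.FluidPDE.oseenDuhamel 1 s v v t x) →
      (∀ t < 0, Literature.Analysis.FluidPDE.VectorCalculus.IsDivFree (v t)) →
      (∀ s < 0, ∀ y, ⟪Literature.Analysis.FluidPDE.curl (v s) y, EuclideanSpace.single 2 1⟫_ℝ = 0) →
      v (-1) 0 2 ≠ 0 → (∀ t < 0, ∀ x, Real.sqrt (-t) * |v t x 2| ≤ |v (-1) 0 2|) →
      ∀ y : EuclideanSpace ℝ (Fin 3), y 2 = 0 → v (-1) y 2 = v (-1) 0 2 → ∀ r : ℝ, 0 < r →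
        ∃ y' : EuclideanSpace ℝ (Fin 3), y' ≠ y ∧ y' 2 = 0 ∧ dist y' y < r ∧ v (-1) y' 2 = v (-1) 0 2 := by
  intro C v hrate hcont hmild hdiv hpol hN hsup y hy0 hyN r hr
  by_contra h
  exact hot_noCompactPiece_of_growth hG C v hrate hcont hmild hdiv hpol hN hsup {y} (ball y r) isCompact_singleton
    (singleton_nonempty y) isOpen_ball (singleton_subset_iff.2 (mem_ball_self hr)) (fun z hz => by rw [mem_singleton_iff.1 hz]; exact ⟨hy0, hyN⟩)
    (fun z hz hz0 hzN => by
      by_contra hne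
      exact h ⟨z, hne, hz0, mem_ball.1 hz, hzN⟩)

end Summit.NavierStokesRegularity.NavierStokesRegularity.Theorems.PoloidalWindowDoorPoloidalWindowRigidityHotLoopsPeakless

end
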